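import Summits.Schanuel.Schanuel.Theorems.RootDecomp1KHyper49

/-!
# RootDecomp1KHyper — lens 6, generation 16/17 «ALGEBRAIC-LATTICE-ANCHORED CELL» (AlgLatAnchor.lean edition 2 42f80a0c…, 1588 l) — continuation (RootDecomp1KHyper50): §F `algebraicIndependent_option_of_mul_algebraic`, lattice bounds `weakLatLB_one_of_im_ne_zero` / `latLB_one_ofReal_of_irrational_root`, `HasAlgLatAnchor` (+ `.mono`, `HasRealQuadAnchor.hasAlgLatAnchor`), THE CELL `sb_three_of_algLatAnchor (hLW)`, the carve `rank3SpanResidual_iff_unanchored₄ (hLW) (h52)`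

(lens-6 g16/g17 `AlgLatAnchor.lean` edition 2, sha256 42f80a0c…8416, own farm rc 0 · 0 sorry · axioms std; critic VERDICT STATUS L1677 / L1713 PORT GO LOW;
port by census-1 gen 15 in six parts `RootDecomp1KHyper47`–`52` — see the PORT NOTE of part 47; `--supports stmt-Schanuel-33363`; rung 0.)
-/

open Complex IntermediateField Polynomial

namespace Summit.Schanuel.Schanuel.Theorems.RootDecomp1KHyper

namespace HyperCell

namespace LatCell

variable {n : ℕ}
open Summit.Schanuel.Schanuel.Theorems.RootDecomp1KGeneric (HasHLPairInSpan Rank3SpanResidual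
  mem_adjoin_of_mem_span cexp_mem_adjoin_of_mem_span)

/-! ## §F  Independence, descent by an algebraic constant, lattice bounds, THE CELL -/

/-- **Weak class principle, algebraic-lattice version.**  `θ` weakly measured, `ω` an algebraic integer,
`y` hyper-approximable from `ℤ + ℤω` ⇒ `(y, θ₁, …, θₙ)` algebraically independent over ℚ. -/
theorem algebraicIndependent_option_of_mvWeakMeasure_hyperAlgLat {θ : Fin n → ℂ}
    (hθ : MvWeakMeasure θ) {ω : ℂ} (hint : IsIntegral ℤ ω) {y : ℂ} (hy : HyperLatApprox 1 ω y) :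
    AlgebraicIndependent ℚ (fun o : Option (Fin n) => o.elim y θ) := by
  have hθi := algebraicIndependent_of_mvWeakMeasure hθ
  rw [hθi.option_iff_transcendental]
  intro halg
  obtain ⟨K, G, hGK, hrel⟩ := exists_int_mvrelation halg
  exact no_int_relation_of_mvWeakMeasure_hyperAlgLat hθ hint hy G ⟨Fin.last K, hGK⟩ hrel

/-- Transcendence descent by an ALGEBRAIC constant: `(c y, θ)` algebraically independent, `c ∈ ℚ̄` ⇒
`(y, θ)` algebraically independent. -/
theorem algebraicIndependent_option_of_mul_algebraic {θ : Fin n → ℂ} {y c : ℂ}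
    (hc : IsAlgebraic ℚ c) (hθ : AlgebraicIndependent ℚ θ)
    (h : AlgebraicIndependent ℚ (fun o : Option (Fin n) => o.elim (c * y) θ)) :
    AlgebraicIndependent ℚ (fun o : Option (Fin n) => o.elim y θ) := by
  rw [hθ.option_iff_transcendental] at h ⊢
  intro hy
  apply h
  have hinj : Function.Injective (algebraMap ℚ (Algebra.adjoin ℚ (Set.range θ))) :=
    (algebraMap ℚ (Algebra.adjoin ℚ (Set.range θ))).injective
  exact (hc.extendScalars hinj).mul hy

/-- A lattice `ℤ + ℤω` with `ω ∉ ℝ` has the (trivial) weak lower bound. -/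
theorem weakLatLB_one_of_im_ne_zero {ω : ℂ} (hω : ω.im ≠ 0) : WeakLatLB 1 ω := by
  set c₀ : ℝ := min 1 |ω.im| with hc₀
  have hc₀pos : 0 < c₀ := lt_min one_pos (abs_pos.mpr hω)
  have hc₀1 : c₀ ≤ 1 := min_le_left _ _
  refine ⟨max 1 (-Real.log c₀), 1, by positivity, fun U V hUV => ?_⟩
  have hlow : c₀ ≤ ‖(U : ℂ) * 1 + (V : ℂ) * ω‖ := by
    rcases eq_or_ne V 0 with hV | hV
    · subst hV
      have hU : U ≠ 0 := by tauto
      have h1 : (1 : ℝ) ≤ |(U : ℝ)| := by rw [← Int.cast_abs]; exact_mod_cast Int.one_le_abs hU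
      rw [Int.cast_zero, zero_mul, add_zero, mul_one, Complex.norm_intCast]
      exact hc₀1.trans h1
    · have h1 : |((U : ℂ) * 1 + (V : ℂ) * ω).im| ≤ ‖(U : ℂ) * 1 + (V : ℂ) * ω‖ :=
        Complex.abs_im_le_norm _
      have h2 : ((U : ℂ) * 1 + (V : ℂ) * ω).im = (V : ℝ) * ω.im := by simp
      rw [h2, abs_mul] at h1
      have hV1 : (1 : ℝ) ≤ |(V : ℝ)| := by rw [← Int.cast_abs]; exact_mod_cast Int.one_le_abs hV
      calc c₀ ≤ |ω.im| := min_le_right _ _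
        _ ≤ |(V : ℝ)| * |ω.im| := le_mul_of_one_le_left (abs_nonneg _) hV1
        _ ≤ _ := h1
  refine le_trans ?_ hlow
  rw [pow_one]
  have h0 : (0 : ℝ) ≤ max 1 (-Real.log c₀) := le_trans zero_le_one (le_max_left _ _)
  have h3 : -Real.log c₀ ≤ max 1 (-Real.log c₀) * (1 + |(U : ℝ)| + |(V : ℝ)|) := by
    calc -Real.log c₀ ≤ max 1 (-Real.log c₀) := le_max_right _ _
      _ = max 1 (-Real.log c₀) * 1 := (mul_one _).symm
      _ ≤ max 1 (-Real.log c₀) * (1 + |(U : ℝ)| + |(V : ℝ)|) :=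
          mul_le_mul_of_nonneg_left (by linarith only [abs_nonneg (U : ℝ), abs_nonneg (V : ℝ)]) h0
  calc Real.exp (-(max 1 (-Real.log c₀) * (1 + |(U : ℝ)| + |(V : ℝ)|)))
      ≤ Real.exp (Real.log c₀) := Real.exp_le_exp.mpr (by linarith only [h3])
    _ = c₀ := Real.exp_log hc₀pos

/-- **Liouville for the lattice `ℤ + ℤα`, `α` a real algebraic irrationality**: a POLYNOMIAL lower bound
(Mathlib's `Liouville.exists_pos_real_of_irrational_root`). -/
theorem latLB_one_ofReal_of_irrational_root {α : ℝ} (hα : Irrational α) {f : ℤ[X]} (hf0 : f ≠ 0)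
    (hfa : Polynomial.aeval (α : ℂ) f = 0) : LatLB 1 (α : ℂ) := by
  have hfaR : Polynomial.eval α (f.map (algebraMap ℤ ℝ)) = 0 := by
    have h1 : (algebraMap ℝ ℂ) (Polynomial.aeval α f) = 0 := by
      rw [← Polynomial.aeval_algebraMap_apply]; exact hfa
    have h2 : Polynomial.aeval α f = 0 := (algebraMap ℝ ℂ).injective (by rw [h1, map_zero])
    rwa [Polynomial.aeval_def, ← Polynomial.eval_map] at h2
  obtain ⟨A, hA, hall⟩ := Liouville.exists_pos_real_of_irrational_root hα hf0 hfaR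
  refine ⟨max A 1, f.natDegree, by positivity, fun U V hUV => ?_⟩
  have hnorm : ‖(U : ℂ) * 1 + (V : ℂ) * (α : ℂ)‖ = |(U : ℝ) + (V : ℝ) * α| := by
    rw [mul_one, show (U : ℂ) + (V : ℂ) * (α : ℂ) = (((U : ℝ) + (V : ℝ) * α : ℝ) : ℂ) by push_cast; ring,
      Complex.norm_real, Real.norm_eq_abs]
  rw [hnorm]
  rcases eq_or_ne V 0 with hV | hV
  · subst hV
    have hU : U ≠ 0 := by tauto
    have h1 : (1 : ℝ) ≤ |(U : ℝ)| := by rw [← Int.cast_abs]; exact_mod_cast Int.one_le_abs hU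
    have h2 : (1 : ℝ) ≤ (1 + |(U : ℝ)|) ^ f.natDegree :=
      one_le_pow₀ (by linarith only [abs_nonneg (U : ℝ)])
    simp only [Int.cast_zero, zero_mul, add_zero, abs_zero]
    calc (1 : ℝ) = 1 * 1 * 1 := by ring
      _ ≤ max A 1 * (1 + |(U : ℝ)|) ^ f.natDegree * |(U : ℝ)| :=
          mul_le_mul (mul_le_mul (le_max_right _ _) h2 zero_le_one (by positivity)) h1 zero_le_one
            (by positivity)
  · have hVR : (V : ℝ) ≠ 0 := by exact_mod_cast hV
    have habsV : (1 : ℝ) ≤ |(V : ℝ)| := by rw [← Int.cast_abs]; exact_mod_cast Int.one_le_abs hV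
    -- a rational a/(b+1) = -U/V with b + 1 = |V|
    obtain ⟨a, b, hb, hab⟩ : ∃ (a : ℤ) (b : ℕ), ((b : ℝ) + 1 = |(V : ℝ)|) ∧
        (α - (a : ℝ) / ((b : ℝ) + 1) = ((U : ℝ) + (V : ℝ) * α) / V) := by
      rcases lt_or_gt_of_ne hV with hneg | hpos
      · have e : (((-V - 1).toNat : ℕ) : ℝ) = -(V : ℝ) - 1 := by
          have h1 := Int.toNat_of_nonneg (show (0 : ℤ) ≤ -V - 1 by omega)
          exact_mod_cast h1
        refine ⟨U, (-V - 1).toNat, ?_, ?_⟩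
        · rw [e, abs_of_neg (by exact_mod_cast hneg)]; ring
        · rw [e, show -(V : ℝ) - 1 + 1 = -(V : ℝ) by ring]
          field_simp
          ring
      · have e : (((V - 1).toNat : ℕ) : ℝ) = (V : ℝ) - 1 := by
          have h1 := Int.toNat_of_nonneg (show (0 : ℤ) ≤ V - 1 by omega)
          exact_mod_cast h1
        refine ⟨-U, (V - 1).toNat, ?_, ?_⟩
        · rw [e, abs_of_pos (by exact_mod_cast hpos)]; ring
        · rw [e, show (V : ℝ) - 1 + 1 = (V : ℝ) by ring]
          field_simp
          push_cast
          ring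
    have h := hall a b
    rw [hab, hb, abs_div] at h
    calc (1 : ℝ) ≤ |(V : ℝ)| ^ f.natDegree * (|(U : ℝ) + (V : ℝ) * α| / |(V : ℝ)| * A) := h
      _ ≤ (1 + |(U : ℝ)| + |(V : ℝ)|) ^ f.natDegree * (|(U : ℝ) + (V : ℝ) * α| / 1 * max A 1) := by
          gcongr
          · linarith only [abs_nonneg (U : ℝ)]
          · exact le_max_left _ _
      _ = max A 1 * (1 + |(U : ℝ)| + |(V : ℝ)|) ^ f.natDegree * |(U : ℝ) + (V : ℝ) * α| := by ring

/-- **`HasAlgLatAnchor z`** — the ℤ-span of the tuple contains two ℚ-linearly independent ALGEBRAIC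
numbers `w₁, w₂` (a rank-2 sublattice of a number field: `ω = w₂/w₁ ∈ ℚ̄ ∖ ℚ` of ANY degree, real or
not).  A property of the lattice `span_ℤ(z)` only (re-basing invariant, padding-monotone). -/
def HasAlgLatAnchor {N : ℕ} (z : Fin N → ℂ) : Prop :=
  ∃ w₁ w₂ : ℂ, IsAlgebraic ℚ w₁ ∧ IsAlgebraic ℚ w₂ ∧ LinearIndependent ℚ ![w₁, w₂] ∧
    w₁ ∈ Submodule.span ℤ (Set.range z) ∧ w₂ ∈ Submodule.span ℤ (Set.range z)

/-- `HasAlgLatAnchor` is monotone along inclusions of `ℤ`-spans (RULE K-R10 gauge invariance). -/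
theorem HasAlgLatAnchor.mono {N N' : ℕ} {z : Fin N → ℂ} {z' : Fin N' → ℂ}
    (hle : Submodule.span ℤ (Set.range z) ≤ Submodule.span ℤ (Set.range z'))
    (h : HasAlgLatAnchor z) : HasAlgLatAnchor z' := by
  obtain ⟨w₁, w₂, h₁, h₂, hli, hm₁, hm₂⟩ := h
  exact ⟨w₁, w₂, h₁, h₂, hli, hle hm₁, hle hm₂⟩

/-- `√D` (as a complex number) is algebraic over ℚ. -/
private theorem isAlgebraic_sqrt_natCast_C' (D : ℕ) : IsAlgebraic ℚ ((Real.sqrt D : ℝ) : ℂ) := by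
  refine ⟨Polynomial.X ^ 2 - Polynomial.C (D : ℚ), Polynomial.X_pow_sub_C_ne_zero (by norm_num) _, ?_⟩
  have hs : ((Real.sqrt D : ℝ) : ℂ) ^ 2 = (D : ℂ) := by
    rw [← Complex.ofReal_pow, Real.sq_sqrt (Nat.cast_nonneg D)]; push_cast; rfl
  simp [hs]

/-- **The Q-cell is a sub-cell**: a real-quadratic anchor `(q₁, q₂√D)` is an algebraic-lattice anchor. -/
theorem HasRealQuadAnchor.hasAlgLatAnchor {N : ℕ} {z : Fin N → ℂ} (h : HasRealQuadAnchor z) :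
    HasAlgLatAnchor z := by
  obtain ⟨D, q₁, q₂, hD, hq₁, hq₂, hm₁, hm₂⟩ := h
  refine ⟨(q₁ : ℂ), (q₂ : ℂ) * ((Real.sqrt D : ℝ) : ℂ), isAlgebraic_algebraMap (R := ℚ) (A := ℂ) q₁,
    (isAlgebraic_algebraMap (R := ℚ) (A := ℂ) q₂).mul (isAlgebraic_sqrt_natCast_C' D), ?_, hm₁, hm₂⟩
  refine LinearIndependent.pair_iff.mpr fun s t hst => ?_
  rw [Rat.smul_def, Rat.smul_def] at hst
  have hre : (s : ℝ) * q₁ + (t : ℝ) * ((q₂ : ℝ) * Real.sqrt D) = 0 := by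
    have h1 := congr_arg Complex.re hst
    simpa [Complex.mul_re] using h1
  by_cases ht : t = 0
  · subst ht
    refine ⟨?_, rfl⟩
    have h2 : (s : ℝ) * q₁ = 0 := by simpa using hre
    have hq₁R : (q₁ : ℝ) ≠ 0 := by exact_mod_cast hq₁
    exact_mod_cast (mul_eq_zero.mp h2).resolve_right hq₁R
  · exfalso
    apply hD
    refine ⟨-(s * q₁) / (t * q₂), ?_⟩
    have htq : (t : ℝ) * q₂ ≠ 0 := mul_ne_zero (by exact_mod_cast ht) (by exact_mod_cast hq₂)
    push_cast
    rw [div_eq_iff htq]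
    linarith only [hre]

set_option maxHeartbeats 800000 in
/-- **THE ALGEBRAIC-LATTICE-ANCHORED CELL (SECOND‴; mod the LW measure).**  A ℚ-free `HyperLinLiouville`
triple whose ℤ-span contains two ℚ-linearly independent algebraic numbers `w₁, w₂` has Schanuel's bound
`trdeg ℚ(z, e^z) ≥ 3`.  Route: `ω = D w₂/w₁` an algebraic integer; weak bound for `ℤw₁ + ℤDw₂` (Liouville
for real `ω`, trivial otherwise); extraction (tree) `HyperLatApprox 1 ω (z_j/w₁)`; the RESULTANT ENGINE with
the LW-measured `θ = (e^{w₁}, e^{Dw₂}) ⊂ ℚ(z, e^z)`; descent by the algebraic constant `w₁⁻¹`. -/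
theorem sb_three_of_algLatAnchor (hLW : LWMeasure) {z : Fin 3 → ℂ} (hz : LinearIndependent ℚ z)
    (hH : HyperLinLiouville z) (hA : HasAlgLatAnchor z) : SB 3 z := by
  obtain ⟨w₁, w₂, halg₁, halg₂, hli, hw₁, hw₂⟩ := hA
  have hpair := LinearIndependent.pair_iff.mp hli
  have hw₁0 : w₁ ≠ 0 := by
    intro h0
    have := (hpair 1 0 (by rw [h0]; simp)).1
    exact one_ne_zero this
  -- an algebraic INTEGER ω = D w₂ / w₁
  have halg₀ : IsAlgebraic ℚ (w₂ / w₁) := halg₂.mul halg₁.inv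
  have halgZ : IsAlgebraic ℤ (w₂ / w₁) := (IsFractionRing.isAlgebraic_iff ℤ ℚ ℂ).mpr halg₀
  obtain ⟨D, hD0, hint⟩ := halgZ.exists_integral_multiple
  rw [zsmul_eq_mul] at hint
  set ω : ℂ := (D : ℂ) * (w₂ / w₁) with hωdef
  set v₂ : ℂ := (D : ℂ) * w₂ with hv₂def
  have hv₂ : v₂ ∈ Submodule.span ℤ (Set.range z) := by
    rw [hv₂def, ← zsmul_eq_mul]; exact Submodule.smul_mem _ _ hw₂
  have hωw : w₁ * ω = v₂ := by rw [hωdef, hv₂def]; field_simp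
  have hωw' : w₁⁻¹ * v₂ = ω := by rw [← hωw, ← mul_assoc, inv_mul_cancel₀ hw₁0, one_mul]
  have hratAlg : ∀ q : ℚ, IsAlgebraic ℚ (q : ℂ) := fun q => by
    simpa using isAlgebraic_algebraMap (R := ℚ) (A := ℂ) q
  have hDalg : IsAlgebraic ℚ (D : ℂ) := by simpa using hratAlg (D : ℚ)
  -- weak lattice lower bound for (1, ω), then for (w₁, v₂)
  have hLB1 : WeakLatLB 1 ω := by
    by_cases hIm : ω.im = 0
    · -- ω is a real algebraic irrationality: Liouville's inequality
      set α : ℝ := ω.re with hαdef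
      have hωα : ω = (α : ℂ) := Complex.ext (by simp [hαdef]) (by simp [hIm])
      have hirr : Irrational α := by
        rintro ⟨q, hq⟩
        have hωq : ω = (q : ℂ) := by rw [hωα, ← hq]; norm_cast
        have hrel : (q : ℚ) • w₁ + (-(D : ℚ)) • w₂ = 0 := by
          rw [Rat.smul_def, Rat.smul_def]
          have h1 : (q : ℂ) * w₁ = (D : ℂ) * w₂ := by rw [← hωq, mul_comm, hωw]
          push_cast
          linear_combination h1
        have h2 := (hpair q (-(D : ℚ)) hrel).2
        exact hD0 (by exact_mod_cast (neg_eq_zero.mp h2))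
      have hf0 : minpoly ℤ ω ≠ 0 := minpoly.ne_zero hint
      have hfa : Polynomial.aeval (α : ℂ) (minpoly ℤ ω) = 0 := by
        rw [← hωα]; exact minpoly.aeval ℤ ω
      have h := latLB_one_ofReal_of_irrational_root hirr hf0 hfa
      rw [← hωα] at h
      exact h.weakLatLB
    · exact weakLatLB_one_of_im_ne_zero hIm
  have hLB : WeakLatLB w₁ v₂ := hLB1.of_mul_left (inv_ne_zero hw₁0) (inv_mul_cancel₀ hw₁0) hωw'
  -- coefficient vectors of the anchors; the extracted coordinate `z_j / w₁ ∈ HyperLatApprox 1 ω`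
  obtain ⟨a, ha⟩ := (Submodule.mem_span_range_iff_exists_fun ℤ).mp hw₁
  obtain ⟨b, hb⟩ := (Submodule.mem_span_range_iff_exists_fun ℤ).mp hv₂
  simp only [zsmul_eq_mul] at ha hb
  obtain ⟨j, hj⟩ := exists_cvec_ne_zeroW hLB ha hb
  have hy := (hyperLatApprox_of_anchorW hz hH hLB ha hb hj).mul_left (inv_ne_zero hw₁0)
  rw [inv_mul_cancel₀ hw₁0, hωw'] at hy
  -- the LW-measured pair θ = (e^{w₁}, e^{v₂}) ⊂ ℚ(z, e^z)
  have hliv : LinearIndependent ℚ ![w₁, v₂] := by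
    refine LinearIndependent.pair_iff.mpr fun s t hst => ?_
    have h := hpair s (t * D) (by
      rw [Rat.smul_def, Rat.smul_def] at hst ⊢
      rw [hv₂def] at hst
      push_cast
      linear_combination hst)
    refine ⟨h.1, ?_⟩
    have hD0' : (D : ℚ) ≠ 0 := by exact_mod_cast hD0
    exact (mul_eq_zero.mp h.2).resolve_right hD0'
  have halgv : ∀ i, IsAlgebraic ℚ (![w₁, v₂] i) := by
    intro i
    fin_cases i
    · exact halg₁
    · exact hDalg.mul halg₂
  have hθ : MvWeakMeasure (fun i => cexp (![w₁, v₂] i)) :=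
    MvPolyMeasure.mvWeakMeasure (mvPolyMeasure_exp_of_LW hLW halgv hliv)
  have hai := algebraicIndependent_option_of_mvWeakMeasure_hyperAlgLat hθ hint hy
  have hai' := algebraicIndependent_option_of_mul_algebraic (y := z j) halg₁.inv
    (algebraicIndependent_of_mvWeakMeasure hθ) hai
  refine sb_of_algebraicIndependent hai' (by simp) fun o => ?_
  rcases o with _ | i
  · exact mem_adjoin_SFset_I' (Or.inl ⟨j, rfl⟩)
  · fin_cases i
    · simpa using cexp_mem_adjoin_of_mem_span hw₁
    · simpa using cexp_mem_adjoin_of_mem_span hv₂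

/-- Pointwise form of the cell (a `rank3SpanResidual_iff_of_cells₃` argument). -/
theorem sb_three_of_algLatAnchor' (hLW : LWMeasure) :
    ∀ z : Fin 3 → ℂ, LinearIndependent ℚ z → HyperLinLiouville z → HasAlgLatAnchor z → SB 3 z :=
  fun _ hz hH hA => sb_three_of_algLatAnchor hLW hz hH hA

/-- **THE CARVE (SECOND‴)**: the residual of record shrinks to the tuples with NO algebraic-lattice
anchor (which subsumes `¬HasRealQuadAnchor`):
`Rank3SpanResidual ↔ UnanchoredResidual₄ := ∀ z, LI → HLL → ¬HLPair → ¬ExpLat → ¬PiLat → ¬AlgLat → SB 3 z`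
(mod the LW measure and Nesterenko–Philippon Cor. 5.2, exactly as the residual of record). -/
theorem rank3SpanResidual_iff_unanchored₄ (hLW : LWMeasure)
    (h52 : Literature.Barriers.Schanuel.NesterenkoPhilippon2001_ch3_cor_5_2) :
    Rank3SpanResidual ↔
      ∀ z : Fin 3 → ℂ, LinearIndependent ℚ z → HyperLinLiouville z → ¬ HasHLPairInSpan z →
        ¬ HasExpLatAnchor z → ¬ HasPiLatAnchor z → ¬ HasAlgLatAnchor z → SB 3 z :=
  rank3SpanResidual_iff_of_cells₃ (fun _ hz hH hA => sb_three_of_expLatAnchor' hLW hz hH hA)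
    (fun _ hz hH hA => sb_three_of_piLatAnchor h52 hz hH hA) (sb_three_of_algLatAnchor' hLW)

/-- The new residual implies the residual of record `UnanchoredResidual₃‴` pointwise-trivially
(`HasRealQuadAnchor ⊆ HasAlgLatAnchor`), i.e. the carve only REMOVES tuples. -/
theorem unanchoredResidual₃_of_unanchoredResidual₄
    (h : ∀ z : Fin 3 → ℂ, LinearIndependent ℚ z → HyperLinLiouville z → ¬ HasHLPairInSpan z →
        ¬ HasExpLatAnchor z → ¬ HasPiLatAnchor z → ¬ HasAlgLatAnchor z → SB 3 z)
    (hQ : ∀ z : Fin 3 → ℂ, LinearIndependent ℚ z → HyperLinLiouville z → HasAlgLatAnchor z → SB 3 z) :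
    ∀ z : Fin 3 → ℂ, LinearIndependent ℚ z → HyperLinLiouville z → ¬ HasHLPairInSpan z →
        ¬ HasRealQuadAnchor z → ¬ HasExpLatAnchor z → ¬ HasPiLatAnchor z → SB 3 z := by
  intro z hz hH hP _ hE hπ
  by_cases hA : HasAlgLatAnchor z
  · exact hQ z hz hH hA
  · exact h z hz hH hP hE hπ hA

end LatCell

end HyperCell

end Summit.Schanuel.Schanuel.Theorems.RootDecomp1KHyper
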